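import Summits.QuantumFields.YangMills.Theorems.BalabanUVNodesN22WindowedCouplingHoloOfJointHolo

/-!
# BalabanUVNodes ∕ node N22 = NE9 — THE REALITY BINDER OF THE ANALYTIC ROAD IS REDUNDANT: by Schwarz reflection `τ ↦ ½(g(τ) + conj g(conj τ))` the REAL PART of the
# field Hessian extends holomorphically in the coupling, so `…N22WindowedCouplingHoloOfJointHolo` §4 holds WITHOUT «the term REAL at real data» on every
# conjugation-symmetric coupling domain

WIDTH SEAT dag-n22-w1 (harness re-seat g5), piece C8 of its own lineage (C1 `…N22WindowedTwoConstants` → C2 `…N22KernelFadingOfStepRateTwoConstants` → C3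
`…N22WindowedCouplingHoloOfJointHolo` → C4 `…N22WindowedCouplingHoloOfLocalTerms` → C6 `…N22JointChartsOfActivityJointHolo`; C5∕C7 = the model inhabitants).  Cell `pub-ymgap`, HUMAN
RULING D-0062 (Track A) ∕ D-0149; `--kind proof --supports stmt-QuantumFields-27366 --as helper` (K3⁸ `SpineGivenEndpointR13SepCoPHV`, KEY MAP v2), COUNT-NEUTRAL.  THEOREMS ONLY
(0 `def`, 0 `sorry`, standard axioms).  Imports C3 (p625707) only; through it J27∕J28 (`hasFDerivAt_re_comp`, `contDiffAt_two_of_holomorphic`), lit `HolomorphicBanach` ∕ `SCV`.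

WHY.  C3 §4 `exists_holo_polScalar` ∕ `windowedCouplingHolo_of_jointChart` — and downstream C4 §1–§3, C6 §3 — carry the binder «the (2.13) term is REAL at real data»
(`hf : 𝒢 (t, ι B) = ((ℰt t (exp ρB) : ℝ) : ℂ)`, `hIm` in C4∕C6): the real polarization kernel `polScalar (ℰt t)` is identified with the COMPLEX field Hessian of the joint chart,
whose imaginary part must then vanish (C3 §1∕§3).  The seat's model work (C7, `…N22JointChartsRealU1Model`) showed the binder is RESTRICTIVE (dag-n22-w2's U(1) model had to be
replaced by its cosine edition to meet it).  It is also UNNECESSARY: the real kernel is the REAL PART of the complex Hessian entry `H(t)` (J28's identification needs no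
reality), and `t ↦ Re H(t)` is the restriction of the holomorphic function `τ ↦ ½(H(τ) + conj H(conj τ))` whenever the coupling domain is symmetric under conjugation — with
the SAME Cauchy bound.  Every strip `{|Im τ| < s}` and every union of discs about real points is symmetric, so at the record the binder disappears at no cost
(sequel `…N22WindowedCouplingHoloOfLocalTermsRe`: C4 §1–§3 without `hIm`).

WHAT (all [folklore]).  §1 SCHWARZ REFLECTION: `hasDerivAt_conj_conj` (`w ↦ conj g(conj w)` has derivative `conj g′(conj z)`), `differentiableOn_conj_conj` (holomorphic on a
conjugation-symmetric open set), ★ `reflectedMean_holo_real_bound` (`½(g + conj g ∘ conj)` is holomorphic there, equals `Re g` on the real axis, and keeps any bound `M` of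
`g`).  §2 ★ `re_fderiv_fderiv_eq_polTensor` — `Re ∂_{ιe₁}∂_{ιe₂} G(0) = Π_f` for `f = Re ∘ G ∘ ι` (the real-part half of C3's `fderiv_fderiv_eq_polTensor`; NO reality of `G`).
§3 ★★ `exists_holo_polScalar_re` (C3's `exists_holo_polScalar` with `hf : Re 𝒢(t, ιB) = ℰt t (exp ρB)` and `Dt` conjugation-symmetric; same bound
`16M R⁻²·(dim)⁻¹Σ_a‖ιe_{x,a}‖‖ιe_{y,a}‖`), ★★★ `windowedCouplingHolo_of_jointChart_re` (C3's headline — the displayed binder `hA` of the kernel-fading road at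
`(h, k, μν, z, m, K)` — from ONE joint chart whose REAL PART agrees with the term family's charts).

HONEST FRAMING (binding).  A hypothesis REDUCTION for the analytic road (count-neutral helper): the joint chart, its bound, the other binders of the road and everything of
Bałaban's remain BINDERS ∕ TYPES ([I] = CMP 109 (1987) p. 263, (1.18)–(1.21) p. 264, §2 p. 266; [II] = CMP 116 (1988) (2.13)–(2.14) pp. 14–15); nothing of the record is
constructed or claimed to meet anything; N22 NOT discharged (typed 28∕28 · discharged 5∕27 UNCHANGED — the chair's single count line is the only count); K3⁸ OPEN, NOT claimed,
no stub touched; one finite 𝕋⁴ programme at fixed ε — R4 closes the CONDITIONAL rung `BalabanLadder.UV` only; NOTHING about the continuum limit, ℝ⁴, OS axioms, a mass gap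
or the Clay problem is proved or claimed by any of this.
-/

noncomputable section

namespace YMDAG.N22.JointHolo

open Filter Metric Set
open scoped BigOperators Topology ComplexConjugate
open Literature.MathematicalPhysics.QuantumFieldTheory.Balaban1983to89
open Literature.MathematicalPhysics.QuantumFieldTheory.Balaban1983to89.B12PolarizationTensor120 (polTensor polComp expChart)
open YMDAG.N22.WindowOfLocalTerms (hasFDerivAt_re_comp contDiffAt_two_of_holomorphic)
open Literature.MathematicalPhysics.QuantumFieldTheory.Balaban1983to89.Node00 (polScalar polWindow siteOfInt TermFamily1)
open Literature.MathematicalPhysics.QuantumFieldTheory.Balaban1983to89.T4Continuum (T4Family)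
open Literature.MathematicalPhysics.QuantumFieldTheory.Balaban1983to89.Node00.U3OfKernels (histPrefix)

/-! ## §1 Schwarz reflection: `τ ↦ conj g(conj τ)` is holomorphic where `g` is, and `½(g + conj g ∘ conj)` is the real part on the real axis -/

section Reflection

/-- **SCHWARZ REFLECTION, pointwise**: if `g` has complex derivative `g′` at `conj z` then `w ↦ conj (g (conj w))` has complex derivative `conj g′` at `z`. [folklore] -/
theorem hasDerivAt_conj_conj {g : ℂ → ℂ} {g' z : ℂ} (h : HasDerivAt g g' (conj z)) :
    HasDerivAt (fun w => conj (g (conj w))) (conj g') z := by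
  rw [hasDerivAt_iff_isLittleO] at h ⊢
  have hc : Tendsto (fun w : ℂ => conj w) (𝓝 z) (𝓝 (conj z)) := (Complex.continuous_conj.tendsto z)
  have h2 := h.comp_tendsto hc
  have h3 : (fun w : ℂ => g (conj w) - g (conj z) - (conj w - conj z) • g') =o[𝓝 z] fun w => w - z := by
    refine h2.trans_isBigO (Asymptotics.IsBigO.of_bound 1 (Filter.Eventually.of_forall fun w => ?_))
    rw [Function.comp_apply, one_mul, ← map_sub, Complex.norm_conj]
  refine (h3.norm_left.congr_left fun w => ?_).of_norm_left
  have hw : conj (g (conj w) - g (conj z) - (conj w - conj z) • g') = conj (g (conj w)) - conj (g (conj z)) - (w - z) • conj g' := by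
    simp only [map_sub, map_mul, smul_eq_mul, Complex.conj_conj]
  rw [← hw, Complex.norm_conj]

/-- **SCHWARZ REFLECTION on a conjugation-symmetric open set**: `g` holomorphic on `D` ⟹ `τ ↦ conj (g (conj τ))` holomorphic on `D`. [folklore] -/
theorem differentiableOn_conj_conj {g : ℂ → ℂ} {D : Set ℂ} (hD : IsOpen D) (hsymm : ∀ τ ∈ D, conj τ ∈ D) (hg : DifferentiableOn ℂ g D) :
    DifferentiableOn ℂ (fun τ => conj (g (conj τ))) D := fun τ hτ =>
  (hasDerivAt_conj_conj ((hg.differentiableAt (hD.mem_nhds (hsymm τ hτ))).hasDerivAt)).differentiableAt.differentiableWithinAt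

/-- **THE REFLECTED MEAN `½(g(τ) + conj g(conj τ))`** is holomorphic on a conjugation-symmetric open `D`, equals `Re g(t)` at every REAL `t`, and is bounded by `M` wherever
`‖g‖ ≤ M` on `D`. [folklore] -/
theorem reflectedMean_holo_real_bound {g : ℂ → ℂ} {D : Set ℂ} (hD : IsOpen D) (hsymm : ∀ τ ∈ D, conj τ ∈ D) (hg : DifferentiableOn ℂ g D) {M : ℝ}
    (hM : ∀ τ ∈ D, ‖g τ‖ ≤ M) :
    DifferentiableOn ℂ (fun τ => (g τ + conj (g (conj τ))) / 2) D ∧ (∀ t : ℝ, (g t + conj (g (conj (t : ℂ)))) / 2 = (((g t).re : ℝ) : ℂ)) ∧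
      ∀ τ ∈ D, ‖(g τ + conj (g (conj τ))) / 2‖ ≤ M := by
  refine ⟨(hg.add (differentiableOn_conj_conj hD hsymm hg)).div_const _, fun t => ?_, fun τ hτ => ?_⟩
  · rw [Complex.conj_ofReal, Complex.add_conj]
    push_cast
    ring
  · have h1 := hM τ hτ
    have h2 : ‖conj (g (conj τ))‖ ≤ M := by rw [Complex.norm_conj]; exact hM _ (hsymm τ hτ)
    calc ‖(g τ + conj (g (conj τ))) / 2‖ = ‖g τ + conj (g (conj τ))‖ / 2 := by rw [norm_div, Complex.norm_two]
      _ ≤ (‖g τ‖ + ‖conj (g (conj τ))‖) / 2 := by gcongr; exact norm_add_le _ _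
      _ ≤ (M + M) / 2 := by gcongr
      _ = M := by ring

end Reflection

/-! ## §2 The REAL PART of the complex field Hessian in real directions is the real polarization kernel of `Re G ∘ ι` — NO reality of `G` needed -/

section Identify

variable {Ec : Type*} [NormedAddCommGroup Ec] [NormedSpace ℂ Ec]
variable {Λ T V : Type*} [Fintype Λ] [Fintype T] [DecidableEq Λ] [DecidableEq T] [NormedAddCommGroup V] [NormedSpace ℝ V]

/-- ★ **`Re ∂_{ιe_{x,v}}∂_{ιe_{y,w}} G (0) = Π_f(x,y)(v,w)` for `f = Re ∘ G ∘ ι`** (`G` holomorphic on an open `U ⊇ ball 0 R`): the REAL-PART half of C3's `fderiv_fderiv_eq_polTensor`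
(J28's identification, `hasFDerivAt_re_comp` twice), which holds WITHOUT the reality of `G` on the image of the real probe space. [folklore] -/
theorem re_fderiv_fderiv_eq_polTensor (G : Ec → ℂ) {U : Set Ec} (hG : DifferentiableOn ℂ G U) (hU : IsOpen U) {R : ℝ} (hR : 0 < R) (hRU : ball (0 : Ec) R ⊆ U)
    (ι : (Λ → T → V) →L[ℝ] Ec) (f : (Λ → T → V) → ℝ) (hf : ∀ B, f B = (G (ι B)).re)
    (μ : Λ) (x : T) (v : V) (ν : Λ) (y : T) (w : V) :
    (fderiv ℂ (fun z => fderiv ℂ G z (ι (Pi.single ν (Pi.single y w)))) 0 (ι (Pi.single μ (Pi.single x v)))).re = polTensor ℝ f μ x v ν y w := by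
  set e₁ : Λ → T → V := Pi.single μ (Pi.single x v) with he₁
  set e₂ : Λ → T → V := Pi.single ν (Pi.single y w) with he₂
  set a : Ec := ι e₁ with ha
  set b : Ec := ι e₂ with hb
  have hι0 : ι 0 ∈ U := by rw [map_zero]; exact hRU (mem_ball_self hR)
  set gw : Ec → ℂ := fun z => fderiv ℂ G z b with hgw
  have hgw_holo : DifferentiableOn ℂ gw U := Literature.Analysis.Complex.SCV.differentiableOn_fderiv_apply hG hU b
  have hpre : ι ⁻¹' U ∈ 𝓝 (0 : Λ → T → V) := ι.continuous.continuousAt.preimage_mem_nhds (hU.mem_nhds hι0)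
  have hfun : f = fun B => (G (ι B)).re := funext hf
  have hD1 : ∀ B : Λ → T → V, ι B ∈ U → fderiv ℝ f B e₂ = (gw (ι B)).re := by
    intro B hBU
    rw [hfun, (hasFDerivAt_re_comp G hG hU ι hBU).fderiv]
    rfl
  have hev : (fun B => fderiv ℝ f B e₂) =ᶠ[𝓝 0] fun B => (gw (ι B)).re :=
    Filter.mem_of_superset hpre fun B hBU => hD1 B hBU
  have hC2 : ContDiffAt ℝ 2 f 0 := by rw [hfun]; exact contDiffAt_two_of_holomorphic G hG hU ι hι0
  have hd : DifferentiableAt ℝ (fderiv ℝ f) 0 :=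
    (hC2.fderiv_right (m := 1) le_rfl).differentiableAt one_ne_zero
  symm
  simp only [polTensor]
  have h := fderiv_clm_apply hd (differentiableAt_const e₂)
  rw [fderiv_fun_const] at h
  simp only [Pi.zero_apply, ContinuousLinearMap.comp_zero, zero_add] at h
  have h' := congrArg (fun L : (Λ → T → V) →L[ℝ] ℝ => L e₁) h
  simp only [ContinuousLinearMap.flip_apply] at h'
  rw [← he₁, ← he₂, ← h', hev.fderiv_eq, (hasFDerivAt_re_comp gw hgw_holo hU ι hι0).fderiv]
  simp only [ContinuousLinearMap.coe_comp, Function.comp_apply, ContinuousLinearMap.coe_restrictScalars', Complex.reCLM_apply, map_zero]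
  rfl

end Identify

/-! ## §3 THE WINDOWED COUPLING-HOLOMORPHY DATUM WITHOUT THE REALITY BINDER (conjugation-symmetric coupling domain) -/

section Window

variable {Ec : Type*} [NormedAddCommGroup Ec] [NormedSpace ℂ Ec]
variable {𝔄 : Type*} [NormedRing 𝔄] [NormedAlgebra ℝ 𝔄]
variable {V : Type*} [NormedAddCommGroup V] [NormedSpace ℝ V] {ι' : Type*} [Fintype ι']
variable {Λ T : Type*} [Fintype Λ] [Fintype T] [DecidableEq Λ] [DecidableEq T]

/-- ★★ **C3's `exists_holo_polScalar` WITHOUT REALITY.**  ONE function `𝒢 : ℂ × Ec → ℂ` complex-differentiable on the open product `Dt × ball(0,R)` with `‖𝒢‖ ≤ M`, `Dt`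
CONJUGATION-SYMMETRIC, whose REAL PART agrees at real couplings with the charts (`Re 𝒢 (t, ι B) = ℰt t (exp ρB)` for `t ∈ ]0,γ]`, all `B` — the term may be COMPLEX at real
data) ⟹ `∃ Fc` holomorphic on `Dt`, bounded by `16M R⁻²·(dim)⁻¹Σ_a ‖ιe_{x,a}‖‖ιe_{y,a}‖`, with `Fc t = polScalar (ℰt t) ρ bV μ x ν y` at every real `t ∈ ]0,γ]`:
`Fc = (dim)⁻¹ Σ_a ½(H_a(τ) + conj H_a(conj τ))` for C3 §2's Hessian entries `H_a` (§1 reflection + §2 real-part identification). [folklore] -/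
theorem exists_holo_polScalar_re (ρ : V →L[ℝ] 𝔄) (bV : Module.Basis ι' ℝ V) (ℰt : ℝ → ((Λ → T → 𝔄) → ℝ))
    {Dt : Set ℂ} (hDt : IsOpen Dt) (hsymm : ∀ τ ∈ Dt, conj τ ∈ Dt) {R M γ : ℝ} (hR : 0 < R) (𝒢 : ℂ × Ec → ℂ)
    (h𝒢 : DifferentiableOn ℂ 𝒢 (Dt ×ˢ ball (0 : Ec) R)) (hM : ∀ p ∈ Dt ×ˢ ball (0 : Ec) R, ‖𝒢 p‖ ≤ M)
    (ι : (Λ → T → V) →L[ℝ] Ec) (hreal : ∀ t ∈ Ioc (0 : ℝ) γ, (t : ℂ) ∈ Dt)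
    (hf : ∀ t ∈ Ioc (0 : ℝ) γ, ∀ B, (𝒢 (t, ι B)).re = expChart (ℰt t) ρ B) (μ : Λ) (x : T) (ν : Λ) (y : T) :
    ∃ Fc : ℂ → ℂ, DifferentiableOn ℂ Fc Dt ∧
      (∀ τ ∈ Dt, ‖Fc τ‖ ≤ 16 * M / R ^ 2 *
        ((Fintype.card ι' : ℝ)⁻¹ * ∑ a, ‖ι (Pi.single μ (Pi.single x (bV a)))‖ * ‖ι (Pi.single ν (Pi.single y (bV a)))‖)) ∧
      (∀ t ∈ Ioc (0 : ℝ) γ, Fc t = ((polScalar (ℰt t) ρ bV μ x ν y : ℝ) : ℂ)) := by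
  set e₁ : ι' → Ec := fun a => ι (Pi.single μ (Pi.single x (bV a))) with he₁
  set e₂ : ι' → Ec := fun a => ι (Pi.single ν (Pi.single y (bV a))) with he₂
  set H : ι' → ℂ → ℂ := fun a τ => fderiv ℂ (fun p => fderiv ℂ 𝒢 p (0, e₂ a)) (τ, 0) (0, e₁ a) with hH
  have hHa := fun a => hessian_holomorphic_of_joint hDt hR 𝒢 h𝒢 hM (e₁ a) (e₂ a)
  have hHb : ∀ a, ∀ τ ∈ Dt, ‖H a τ‖ ≤ 16 * M / R ^ 2 * ‖e₁ a‖ * ‖e₂ a‖ := fun a τ hτ => by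
    have h := (hHa a).2 τ hτ
    rw [hH]; dsimp only
    rw [h.1]; exact h.2
  have hRa := fun a => reflectedMean_holo_real_bound hDt hsymm (hHa a).1 (hHb a)
  refine ⟨fun τ => ((Fintype.card ι' : ℝ)⁻¹ : ℂ) * ∑ a, (H a τ + conj (H a (conj τ))) / 2, ?_, ?_, ?_⟩
  · refine (DifferentiableOn.const_mul ?_ _)
    have hfun : (fun τ => ∑ a, (H a τ + conj (H a (conj τ))) / 2) = ∑ a, fun τ => (H a τ + conj (H a (conj τ))) / 2 := by
      funext τ; simp only [Finset.sum_apply]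
    rw [hfun]
    exact DifferentiableOn.sum fun a _ => (hRa a).1
  · intro τ hτ
    have hsum : ‖∑ a, (H a τ + conj (H a (conj τ))) / 2‖ ≤ ∑ a, 16 * M / R ^ 2 * ‖e₁ a‖ * ‖e₂ a‖ :=
      (norm_sum_le _ _).trans (Finset.sum_le_sum fun a _ => (hRa a).2.2 τ hτ)
    have hcard : 0 ≤ (Fintype.card ι' : ℝ)⁻¹ := inv_nonneg.2 (Nat.cast_nonneg _)
    rw [norm_mul, norm_inv, Complex.norm_real, Real.norm_natCast]
    rw [Finset.mul_sum]
    calc (Fintype.card ι' : ℝ)⁻¹ * ‖∑ a, (H a τ + conj (H a (conj τ))) / 2‖ ≤ (Fintype.card ι' : ℝ)⁻¹ * ∑ a, 16 * M / R ^ 2 * ‖e₁ a‖ * ‖e₂ a‖ :=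
          mul_le_mul_of_nonneg_left hsum hcard
      _ = 16 * M / R ^ 2 * ∑ a, (Fintype.card ι' : ℝ)⁻¹ * (‖e₁ a‖ * ‖e₂ a‖) := by
          rw [Finset.mul_sum, Finset.mul_sum]
          exact Finset.sum_congr rfl fun a _ => by ring
  · intro t ht
    have hG : DifferentiableOn ℂ (fun B => 𝒢 ((t : ℂ), B)) (ball (0 : Ec) R) := differentiableOn_slice h𝒢 (hreal t ht)
    have hterm : ∀ a, (H a t + conj (H a (conj (t : ℂ)))) / 2 = ((polTensor ℝ (expChart (ℰt t) ρ) μ x (bV a) ν y (bV a) : ℝ) : ℂ) := by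
      intro a
      rw [(hRa a).2.1 t]
      congr 1
      rw [((hHa a).2 (t : ℂ) (hreal t ht)).1]
      exact re_fderiv_fderiv_eq_polTensor (fun B => 𝒢 ((t : ℂ), B)) hG isOpen_ball hR subset_rfl ι (expChart (ℰt t) ρ)
        (fun B => (hf t ht B).symm) μ x (bV a) ν y (bV a)
    simp only [polScalar, polComp, hterm]
    push_cast
    rfl

/-- ★★★ **C3's `windowedCouplingHolo_of_jointChart` WITHOUT REALITY**: the DISPLAYED binder `hA` of the kernel-fading road at `(h, k, μν, z, m, K)` from ONE joint chart `𝒢` whose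
REAL PART agrees with the term family's charts at real couplings (`Re 𝒢 (t, ι B) = ℰ k (h|h_m:=t)_{≤k} K (exp ρB)`), on a CONJUGATION-SYMMETRIC `Dt ⊇` the closed `r`-discs about
`]0, γ]` (e.g. any strip or any union of discs about real points). [folklore] -/
theorem windowedCouplingHolo_of_jointChart_re (F : T4Family) (ℰ : TermFamily1 F 𝔄) (ρ : V →L[ℝ] 𝔄) (bV : Module.Basis ι' ℝ V)
    (h : ℕ → ℝ) (m k K : ℕ) (μ ν : Fin 4) (z : Fin 4 → ℤ)
    {Dt : Set ℂ} (hDt : IsOpen Dt) (hsymm : ∀ τ ∈ Dt, conj τ ∈ Dt) {R M γ r Bd : ℝ} (hR : 0 < R) (hr : 0 ≤ r) (𝒢 : ℂ × Ec → ℂ)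
    (h𝒢 : DifferentiableOn ℂ 𝒢 (Dt ×ˢ ball (0 : Ec) R)) (hM : ∀ p ∈ Dt ×ˢ ball (0 : Ec) R, ‖𝒢 p‖ ≤ M)
    (ι : (Fin (F.P K).d → Site (F.P K) (k + 1) → V) →L[ℝ] Ec) (hdisc : ∀ t ∈ Ioc (0 : ℝ) γ, closedBall (t : ℂ) r ⊆ Dt)
    (hf : ∀ t ∈ Ioc (0 : ℝ) γ, ∀ B, (𝒢 (t, ι B)).re = expChart (ℰ k (histPrefix (Function.update h m t) k) K) ρ B)
    (hBd : 16 * M / R ^ 2 * ((Fintype.card ι' : ℝ)⁻¹ *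
      ∑ a, ‖ι (Pi.single (Fin.cast (F.P_d K).symm μ) (Pi.single (siteOfInt F K (k + 1) z) (bV a)))‖ *
        ‖ι (Pi.single (Fin.cast (F.P_d K).symm ν) (Pi.single (siteOfInt F K (k + 1) 0) (bV a)))‖) ≤ Bd) :
    ∃ (Fc : ℂ → ℂ) (D : Set ℂ), DifferentiableOn ℂ Fc D ∧ (∀ w ∈ D, ‖Fc w‖ ≤ Bd) ∧
      (∀ t ∈ Ioc (0 : ℝ) γ, closedBall (t : ℂ) r ⊆ D) ∧
      (∀ t ∈ Ioc (0 : ℝ) γ, Fc t = (polWindow F K (k + 1) (ℰ k (histPrefix (Function.update h m t) k) K) ρ bV μ ν z : ℂ)) := by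
  have hreal : ∀ t ∈ Ioc (0 : ℝ) γ, (t : ℂ) ∈ Dt := fun t ht => hdisc t ht (mem_closedBall_self hr)
  obtain ⟨Fc, hFc, hbd, hagree⟩ := exists_holo_polScalar_re ρ bV (fun t => ℰ k (histPrefix (Function.update h m t) k) K) hDt hsymm hR 𝒢 h𝒢 hM ι hreal hf
    (Fin.cast (F.P_d K).symm μ) (siteOfInt F K (k + 1) z) (Fin.cast (F.P_d K).symm ν) (siteOfInt F K (k + 1) 0)
  exact ⟨Fc, Dt, hFc, fun w hw => (hbd w hw).trans hBd, hdisc, fun t ht => hagree t ht⟩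

end Window

end YMDAG.N22.JointHolo

end
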